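import Summits.KontsevichZagierPeriods.KontsevichZagierPeriods.Theses.GammaCornerAnomaly

/-!
# `LegendreMUMConstant` (stmt-KontsevichZagierPeriods-8976, route GammaCornerAnomaly) — birth skeleton

Crux (rank 2, difficulty XL): for every rational `λ ∈ (0,1)`, every KZ representation `r` on `(0,1)²` of
`j_λ(x,t) = ((t(1−t)(1−λxt))^{−1/2} − (t(1−t)(1−λx²t))^{−1/2})/(1−x)` (value
`J(λ) = π Σ aₙλⁿ(H₂ₙ − Hₙ)`) is `KZ.Equivalent` to every representation `r'` on `(0,1)²` of
`−(2/(1+x²))κ_{1−λ}(t) + (3/(1+3x) + (1−λ)/(2(λ+(1−λ)x)))κ_λ(t)`, `κ_m(t) = (t(1−t)(1−mt))^{−1/2}/2`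
(value `−(π/2)K′(λ) + K(λ) log 4 + ½K(λ) log(1/λ)`); i.e. the weight-1 MUM identity
`πK′ + K log λ − K log 16 + 2J = 0` (Frobenius constant `κ₁ = log 16`) inside the rules.

Line "birth" = the route header's reading of the constant, `log 16 = log 4 + log 4` from the two strata of the
corner, typed as a three-term chain in `KZ.FormalRep` over existing declarations only.  Write
`k_λ(x,t) = (t(1−t)(1−λxt))^{−1/2}`, so `j_λ = (k_λ(x,t) − k_λ(x²,t))/(1−x)` and `∫₀¹ k_λ(x,t) dt = 2K(λx)`.

* STRATUM ONE IS ELEMENTARY (`stub_unfoldStratum`, rules 1b/2/1b/1b only).  Insert `∓k_λ(1,t)/(1−x)`: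
  both difference quotients `(k_λ(x,t) − k_λ(1,t))/(1−x)` and `(k_λ(1,t) − k_λ(x²,t))/(1−x)` are absolutely
  integrable (`λ < 1`), un-square the first by the change of variables `x = u²` (Jacobian `2u`), re-add:
  `(k(u²,t) − k(1,t))·(2u/(1−u²) − 1/(1−u)) = −(k(u²,t) − k(1,t))/(1+u)`.  Hence, with the two
  representations on `(0,1)²`
      `c` : `k_λ(u²,t)/(1+u)`   (value `C(λ) = 2∫₀¹ K(λu²) du/(1+u)`, continuous at the corner, `C(0) = π log 2`),
      `e` : `k_λ(1,t)/(1+u)`    (value `2K(λ)·log 2 = K(λ)·log 4` — the first `log 4` stratum),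
  one has `[r] + [c] − [e] ∈ KZ.relations` (`J + C = K log 4`).
* THE `log 4` TERM OF `r'` IS THAT STRATUM (`stub_peelLogFour`, rules 1b/2/1a/2/1b): the summand
  `(3/(1+3x))κ_λ(t)` of `r'` (value `K log 4`) matches `e` by `v = 3x`, `(0,3) = (0,1] ∪ (1,3)`, `v = 1 + 2u`
  and `[2f] = [f] + [f]`; what is left of `r'` is the representation
      `w` : `(2/(1+x²))κ_{1−λ}(t) − ((1−λ)/(2(λ+(1−λ)x)))κ_λ(t)`   (value `(π/2)K′(λ) + ½K(λ) log λ`),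
  and `[e] − [r'] − [w] ∈ KZ.relations`.
* THE KERNEL (`stub_regularPartIdentity`, XL — the crux's real content, corner-free of `log 16`):
  `[w] − [c] ∈ KZ.relations`, i.e. inside the rules
      `(π/2)K(1−λ) + ½K(λ) log λ = 2∫₀¹ K(λu²) du/(1+u)`            (⋆)
  — the REGULAR PART of the log-Frobenius solution at the MUM point `λ = 0` (the left side is analytic
  at `0` although its two terms diverge separately; its value at `0`, `(π/4) log 16 − … → (π/2) log 4`, is the
  second `log 4` stratum) equals an explicit corner-continuous 2-dimensional period of the same pencil.
  (⋆) is exactly `LegendreMUMConstant` with the elementary stratum removed: no new transcendental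
  constant, one fewer term, and a right side that extends continuously to the corner.

Composition: the arrow form `legendreMUMConstant_of_stubs : stub₁-sig → stub₂-sig → stub₃-sig → (crux verbatim)`
is sorry-free (`[r] − [r'] = ([r] + [c] − [e]) + ([e] − [r'] − [w]) + ([w] − [c])` in the free abelian group,
`abel` + `add_mem`), and the skeleton theorem `LegendreMUMConstant_of : LegendreMUMConstant` feeds the three stubs
into it — the only theorem here concluding the crux by name (A12 convention of the registered skeletons).

Value audit (registrar, pure-Python Gauss–Legendre after `t = sin²θ`, file `num/chain_check.py` in the session
folder, attached as evidence): at `λ ∈ {1/3, 1/2, 1/5}` the three balances `J + C − E`, `E − value(r') − value(w)`,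
`value(w) − C` are `≤ 2.3e−15`; e.g. `λ = 1/3`: `J = 0.169088893705`, `C = 2.234630306978 = K log 4 − J`,
`E = 2.403719200684 = K log 4`, `value(w) = 2.234630306978 = (π/2)K′ + ½K log λ`.  So no stub is value-false
(`KZ.Equivalent.value_eq_holds`), and stubs 1–2 are balanced by ELEMENTARY identities (independent of the crux).

Disproof used: none on file (`Cruxes/LegendreMUMConstant/` did not exist before this file; no `Disproof.lean`, no
crux ideas, no dead lines; `ledger negatives --problem KontsevichZagierPeriods` has no statement about this pencil's
MUM pair).  Barrier `Literature.Barriers.KontsevichZagierPeriods.noSemialgebraicPrimitive_inv_sub_two`: not engaged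
by stubs 1–2 (changes of variables `u ↦ u²`, `x ↦ 3x`, `v ↦ 1 + 2u` and additivity only; `log 2`, `log 4` stay
unfolded as `∫ du/(1+u)`); CONFRONTED, as in the route header, by stub 3 alone.
-/

set_option linter.dupNamespace false

namespace Summit.KontsevichZagierPeriods.KontsevichZagierPeriods.Cruxes.LegendreMUMConstant.Birth

open Summit.KontsevichZagierPeriods.KontsevichZagierPeriods.Theses.GammaCornerAnomaly (LegendreMUMConstant)

/-- Stub 1 (STRATUM ONE, elementary unfolding — moves (1b), (2), (1b), (1b)): for every rational
`λ ∈ (0,1)` and every representation `r` of the crux integrand `j_λ = (k_λ(x,t) − k_λ(x²,t))/(1−x)` on `(0,1)²`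
(`k_λ(x,t) = (t(1−t)(1−λxt))^{−1/2}`), there are representations `c` of `k_λ(u²,t)/(1+u)` and `e` of
`k_λ(1,t)/(1+u)` on `(0,1)²` with `[r] + [c] − [e] ∈ KZ.relations` (`J(λ) + C(λ) = K(λ) log 4`).  Plan: split
`j_λ = (k(x,t) − k(1,t))/(1−x) + (k(1,t) − k(x²,t))/(1−x)` (rule 1b; both difference quotients are absolutely
integrable since `λ < 1`), change variables `x = u²` in the first summand (rule 2, `Φ(u,t) = (u²,t)` on `(0,1)²`,
Jacobian `2u`, injective, onto `(0,1)²`), re-add (rule 1b):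
`(k(u²,t) − k(1,t))(2u/(1−u²) − 1/(1−u)) = (k(1,t) − k(u²,t))/(1+u) = e − c` (rule 1b).  The representations
`c`, `e` must be CONSTRUCTED (ℚ-semialgebraic graphs of the `rpow` integrands on the open square; integrability:
`(t(1−t))^{−1/2}` in `t`, bounded in `u`).  Why it might fail: only the move-hypothesis bookkeeping
(`IsSemialgebraicFunOn` for `rpow (−1/2)` integrands, `HasFDerivWithinAt`/`InjOn` of `Φ`, integrability of the two
difference quotients).  Size M.  [cite: KontsevichZagier2001, §1.2 rules (1),(2)] -/
theorem stub_unfoldStratum :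
    ∀ l : ℚ, 0 < l → l < 1 → ∀ (r : Literature.NumberTheory.Transcendental.KZ.IntegralRep 2),
      r.domain = {q | ∀ i, q i ∈ Set.Ioo (0:ℝ) 1} →
      Set.EqOn r.integrand
        (fun q => (((q 1 * (1 - q 1) * (1 - (l:ℝ) * q 0 * q 1)) ^ (-(1:ℝ)/2) -
                  (q 1 * (1 - q 1) * (1 - (l:ℝ) * q 0 ^ 2 * q 1)) ^ (-(1:ℝ)/2)) / (1 - q 0))) r.domain →
      ∃ (c e : Literature.NumberTheory.Transcendental.KZ.IntegralRep 2),
        c.domain = {q | ∀ i, q i ∈ Set.Ioo (0:ℝ) 1} ∧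
        Set.EqOn c.integrand
          (fun q => (q 1 * (1 - q 1) * (1 - (l:ℝ) * q 0 ^ 2 * q 1)) ^ (-(1:ℝ)/2) / (1 + q 0)) c.domain ∧
        e.domain = {q | ∀ i, q i ∈ Set.Ioo (0:ℝ) 1} ∧
        Set.EqOn e.integrand
          (fun q => (q 1 * (1 - q 1) * (1 - (l:ℝ) * q 1)) ^ (-(1:ℝ)/2) / (1 + q 0)) e.domain ∧
        Literature.NumberTheory.Transcendental.KZ.of r + Literature.NumberTheory.Transcendental.KZ.of c -
          Literature.NumberTheory.Transcendental.KZ.of e ∈ Literature.NumberTheory.Transcendental.KZ.relations := by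
  sorry

/-- Stub 2 (PEEL THE `log 4` STRATUM OFF `r'` — moves (1b), (2), (1a), (2), (1b)): for every rational
`λ ∈ (0,1)`, every representation `e` of `k_λ(1,t)/(1+u)` on `(0,1)²` (value `K(λ) log 4`) and every
representation `r'` of the crux's target integrand `−(2/(1+x²))κ_{1−λ}(t) + (3/(1+3x) + (1−λ)/(2(λ+(1−λ)x)))κ_λ(t)`,
there is a representation `w` of the remainder `(2/(1+x²))κ_{1−λ}(t) − ((1−λ)/(2(λ+(1−λ)x)))κ_λ(t)` on `(0,1)²`
(value `(π/2)K(1−λ) + ½K(λ) log λ`) with `[e] − [r'] − [w] ∈ KZ.relations`.  Plan: with `r₂` a representation of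
`(3/(1+3x))κ_λ(t)`, `[r₂] − [r'] − [w]` is ONE integrand-additivity instance (`r₂ = r' + w` pointwise on the
square, `ring`); and `[e] − [r₂] ∈ relations` elementarily: `v = 3x` (rule 2) turns `r₂` into `κ_λ(t)/(1+v)` on
`(0,3) × (0,1)`, domain additivity `(0,3) = (0,1] ∪ (1,3)` (rule 1a, null seam), `v = 1 + 2u` (rule 2) maps the
second piece onto `κ_λ(t)/(1+u)` on `(0,1)²`, and `e = 2κ_λ(t)/(1+u) = κ/(1+u) + κ/(1+u)` (rule 1b):
`log 4 = log 2 + log 2`, the logarithms unfolded as `∫ du/(1+u)`.  Why it might fail: bookkeeping only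
(constructing `w`, `r₂` and the scaled pieces as `IntegralRep`s; the null seam `{1} × (0,1)`).  Size M.
[cite: KontsevichZagier2001, §1.2 rules (1),(2)] -/
theorem stub_peelLogFour :
    ∀ l : ℚ, 0 < l → l < 1 → ∀ (e r' : Literature.NumberTheory.Transcendental.KZ.IntegralRep 2),
      e.domain = {q | ∀ i, q i ∈ Set.Ioo (0:ℝ) 1} →
      Set.EqOn e.integrand
        (fun q => (q 1 * (1 - q 1) * (1 - (l:ℝ) * q 1)) ^ (-(1:ℝ)/2) / (1 + q 0)) e.domain →
      r'.domain = {q | ∀ i, q i ∈ Set.Ioo (0:ℝ) 1} →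
      Set.EqOn r'.integrand
        (fun q => (-(2 / (1 + q 0 ^ 2)) * ((q 1 * (1 - q 1) * (1 - (1 - (l:ℝ)) * q 1)) ^ (-(1:ℝ)/2) / 2) +
                  (3 / (1 + 3 * q 0) + (1 - (l:ℝ)) / (2 * ((l:ℝ) + (1 - (l:ℝ)) * q 0))) *
                    ((q 1 * (1 - q 1) * (1 - (l:ℝ) * q 1)) ^ (-(1:ℝ)/2) / 2))) r'.domain →
      ∃ (w : Literature.NumberTheory.Transcendental.KZ.IntegralRep 2),
        w.domain = {q | ∀ i, q i ∈ Set.Ioo (0:ℝ) 1} ∧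
        Set.EqOn w.integrand
          (fun q => (2 / (1 + q 0 ^ 2)) * ((q 1 * (1 - q 1) * (1 - (1 - (l:ℝ)) * q 1)) ^ (-(1:ℝ)/2) / 2) -
                    ((1 - (l:ℝ)) / (2 * ((l:ℝ) + (1 - (l:ℝ)) * q 0))) * ((q 1 * (1 - q 1) * (1 - (l:ℝ) * q 1)) ^ (-(1:ℝ)/2) / 2)) w.domain ∧
        Literature.NumberTheory.Transcendental.KZ.of e - Literature.NumberTheory.Transcendental.KZ.of r' -
          Literature.NumberTheory.Transcendental.KZ.of w ∈ Literature.NumberTheory.Transcendental.KZ.relations := by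
  sorry

/-- Stub 3 (THE KERNEL — the regular part of the log-Frobenius solution, corner-free of `log 16`): for every
rational `λ ∈ (0,1)`, every representation `w` of `(2/(1+x²))κ_{1−λ}(t) − ((1−λ)/(2(λ+(1−λ)x)))κ_λ(t)` on `(0,1)²`
(value `(π/2)K(1−λ) + ½K(λ) log λ`, analytic at `λ = 0` with value `(π/2) log 4` there although its two terms
diverge separately) is `KZ.Equivalent` to every representation `c` of `(t(1−t)(1−λu²t))^{−1/2}/(1+u)` on `(0,1)²`
(value `C(λ) = 2∫₀¹ K(λu²) du/(1+u) = π Σ aₙλⁿ(log 2 − (H₂ₙ − Hₙ))`, `aₙ = (C(2n,n)/4ⁿ)²`, continuous at the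
corner).  This is `LegendreMUMConstant` with the elementary stratum removed (stubs 1–2), equivalent to it in
value by `J + C = K log 4`; verified to `≤ 2.3e−15` at `λ ∈ {1/5, 1/3, 1/2}`.  Why it might fail: the crux's own
risk, undiminished in kind — every known proof of (⋆) is analytic (hypergeometric connection formula /
`λ → 0` asymptotics / Mellin inversion of `κ(s) = 16^s Γ(1+s)⁴/Γ(1+2s)²`); a finite chain must produce the
`K(1−λ)`-term, i.e. anchor a non-conserved flat section, and the only in-rules handles in view are λ-transport
with a rational certificate from a CM or corner anchor (the pattern of the route supports LogWronskianTransport and LogWronskianAnchor) or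
corner regularisation on the blown-up family (Deregularisation's Λ / StandardParts' SpArcClosure).  What the
reduction buys: the right side is ONE corner-continuous algebraic family (no difference quotient, no `log 16`),
so a transport-from-the-corner argument has a finite anchor `C(0) = π log 2 = [ (0,1)², κ₀(t)·2/(1+u) ]`.
Size XL.  [cite: KontsevichZagier2001, §1.2 Conjecture 1] [cite: arXiv:2206.15181, (3)] -/
theorem stub_regularPartIdentity :
    ∀ l : ℚ, 0 < l → l < 1 → ∀ (w c : Literature.NumberTheory.Transcendental.KZ.IntegralRep 2),
      w.domain = {q | ∀ i, q i ∈ Set.Ioo (0:ℝ) 1} →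
      Set.EqOn w.integrand
        (fun q => (2 / (1 + q 0 ^ 2)) * ((q 1 * (1 - q 1) * (1 - (1 - (l:ℝ)) * q 1)) ^ (-(1:ℝ)/2) / 2) -
                  ((1 - (l:ℝ)) / (2 * ((l:ℝ) + (1 - (l:ℝ)) * q 0))) * ((q 1 * (1 - q 1) * (1 - (l:ℝ) * q 1)) ^ (-(1:ℝ)/2) / 2)) w.domain →
      c.domain = {q | ∀ i, q i ∈ Set.Ioo (0:ℝ) 1} →
      Set.EqOn c.integrand
        (fun q => (q 1 * (1 - q 1) * (1 - (l:ℝ) * q 0 ^ 2 * q 1)) ^ (-(1:ℝ)/2) / (1 + q 0)) c.domain →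
      Literature.NumberTheory.Transcendental.KZ.Equivalent w c := by
  sorry

open Literature.NumberTheory.Transcendental

/-- **Composition, arrow form** (sorry-free): the three relations chained in the free abelian group
`KZ.FormalRep`, `[r] − [r'] = ([r] + [c] − [e]) + ([e] − [r'] − [w]) + ([w] − [c])` (`abel` + `add_mem`).  The
conclusion is the crux statement UNFOLDED VERBATIM, so that exactly one theorem of this file,
`LegendreMUMConstant_of`, concludes the crux by name (A12 skeleton audit). [cite: KontsevichZagier2001, §1.2] -/
theorem legendreMUMConstant_of_stubs
    (hUnfold : ∀ l : ℚ, 0 < l → l < 1 → ∀ (r : Literature.NumberTheory.Transcendental.KZ.IntegralRep 2),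
      r.domain = {q | ∀ i, q i ∈ Set.Ioo (0:ℝ) 1} →
      Set.EqOn r.integrand
        (fun q => (((q 1 * (1 - q 1) * (1 - (l:ℝ) * q 0 * q 1)) ^ (-(1:ℝ)/2) -
                  (q 1 * (1 - q 1) * (1 - (l:ℝ) * q 0 ^ 2 * q 1)) ^ (-(1:ℝ)/2)) / (1 - q 0))) r.domain →
      ∃ (c e : Literature.NumberTheory.Transcendental.KZ.IntegralRep 2),
        c.domain = {q | ∀ i, q i ∈ Set.Ioo (0:ℝ) 1} ∧
        Set.EqOn c.integrand
          (fun q => (q 1 * (1 - q 1) * (1 - (l:ℝ) * q 0 ^ 2 * q 1)) ^ (-(1:ℝ)/2) / (1 + q 0)) c.domain ∧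
        e.domain = {q | ∀ i, q i ∈ Set.Ioo (0:ℝ) 1} ∧
        Set.EqOn e.integrand
          (fun q => (q 1 * (1 - q 1) * (1 - (l:ℝ) * q 1)) ^ (-(1:ℝ)/2) / (1 + q 0)) e.domain ∧
        Literature.NumberTheory.Transcendental.KZ.of r + Literature.NumberTheory.Transcendental.KZ.of c -
          Literature.NumberTheory.Transcendental.KZ.of e ∈ Literature.NumberTheory.Transcendental.KZ.relations)
    (hPeel : ∀ l : ℚ, 0 < l → l < 1 → ∀ (e r' : Literature.NumberTheory.Transcendental.KZ.IntegralRep 2),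
      e.domain = {q | ∀ i, q i ∈ Set.Ioo (0:ℝ) 1} →
      Set.EqOn e.integrand
        (fun q => (q 1 * (1 - q 1) * (1 - (l:ℝ) * q 1)) ^ (-(1:ℝ)/2) / (1 + q 0)) e.domain →
      r'.domain = {q | ∀ i, q i ∈ Set.Ioo (0:ℝ) 1} →
      Set.EqOn r'.integrand
        (fun q => (-(2 / (1 + q 0 ^ 2)) * ((q 1 * (1 - q 1) * (1 - (1 - (l:ℝ)) * q 1)) ^ (-(1:ℝ)/2) / 2) +
                  (3 / (1 + 3 * q 0) + (1 - (l:ℝ)) / (2 * ((l:ℝ) + (1 - (l:ℝ)) * q 0))) *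
                    ((q 1 * (1 - q 1) * (1 - (l:ℝ) * q 1)) ^ (-(1:ℝ)/2) / 2))) r'.domain →
      ∃ (w : Literature.NumberTheory.Transcendental.KZ.IntegralRep 2),
        w.domain = {q | ∀ i, q i ∈ Set.Ioo (0:ℝ) 1} ∧
        Set.EqOn w.integrand
          (fun q => (2 / (1 + q 0 ^ 2)) * ((q 1 * (1 - q 1) * (1 - (1 - (l:ℝ)) * q 1)) ^ (-(1:ℝ)/2) / 2) -
                    ((1 - (l:ℝ)) / (2 * ((l:ℝ) + (1 - (l:ℝ)) * q 0))) * ((q 1 * (1 - q 1) * (1 - (l:ℝ) * q 1)) ^ (-(1:ℝ)/2) / 2)) w.domain ∧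
        Literature.NumberTheory.Transcendental.KZ.of e - Literature.NumberTheory.Transcendental.KZ.of r' -
          Literature.NumberTheory.Transcendental.KZ.of w ∈ Literature.NumberTheory.Transcendental.KZ.relations)
    (hCore : ∀ l : ℚ, 0 < l → l < 1 → ∀ (w c : Literature.NumberTheory.Transcendental.KZ.IntegralRep 2),
      w.domain = {q | ∀ i, q i ∈ Set.Ioo (0:ℝ) 1} →
      Set.EqOn w.integrand
        (fun q => (2 / (1 + q 0 ^ 2)) * ((q 1 * (1 - q 1) * (1 - (1 - (l:ℝ)) * q 1)) ^ (-(1:ℝ)/2) / 2) -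
                  ((1 - (l:ℝ)) / (2 * ((l:ℝ) + (1 - (l:ℝ)) * q 0))) * ((q 1 * (1 - q 1) * (1 - (l:ℝ) * q 1)) ^ (-(1:ℝ)/2) / 2)) w.domain →
      c.domain = {q | ∀ i, q i ∈ Set.Ioo (0:ℝ) 1} →
      Set.EqOn c.integrand
        (fun q => (q 1 * (1 - q 1) * (1 - (l:ℝ) * q 0 ^ 2 * q 1)) ^ (-(1:ℝ)/2) / (1 + q 0)) c.domain →
      Literature.NumberTheory.Transcendental.KZ.Equivalent w c) :
    ∀ l : ℚ, 0 < l → l < 1 → ∀ (r r' : Literature.NumberTheory.Transcendental.KZ.IntegralRep 2),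
      r.domain = {q | ∀ i, q i ∈ Set.Ioo (0:ℝ) 1} →
      Set.EqOn r.integrand
        (fun q => (((q 1 * (1 - q 1) * (1 - (l:ℝ) * q 0 * q 1)) ^ (-(1:ℝ)/2) -
                  (q 1 * (1 - q 1) * (1 - (l:ℝ) * q 0 ^ 2 * q 1)) ^ (-(1:ℝ)/2)) / (1 - q 0))) r.domain →
      r'.domain = {q | ∀ i, q i ∈ Set.Ioo (0:ℝ) 1} →
      Set.EqOn r'.integrand
        (fun q => (-(2 / (1 + q 0 ^ 2)) * ((q 1 * (1 - q 1) * (1 - (1 - (l:ℝ)) * q 1)) ^ (-(1:ℝ)/2) / 2) +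
                  (3 / (1 + 3 * q 0) + (1 - (l:ℝ)) / (2 * ((l:ℝ) + (1 - (l:ℝ)) * q 0))) *
                    ((q 1 * (1 - q 1) * (1 - (l:ℝ) * q 1)) ^ (-(1:ℝ)/2) / 2))) r'.domain →
      Literature.NumberTheory.Transcendental.KZ.Equivalent r r' := by
  intro l hl hl' r r' hr hri hr' hri'
  obtain ⟨c, e, hc, hci, he, hei, m₁⟩ := hUnfold l hl hl' r hr hri
  obtain ⟨w, hw, hwi, m₂⟩ := hPeel l hl hl' e r' he hei hr' hri'
  have m₃ : KZ.of w - KZ.of c ∈ KZ.relations := hCore l hl hl' w c hw hwi hc hci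
  show KZ.of r - KZ.of r' ∈ KZ.relations
  have key : KZ.of r - KZ.of r' =
      (KZ.of r + KZ.of c - KZ.of e) + (KZ.of e - KZ.of r' - KZ.of w) + (KZ.of w - KZ.of c) := by
    abel
  rw [key]
  exact add_mem (add_mem m₁ m₂) m₃

/-- **The skeleton theorem** `LegendreMUMConstant_of` (concludes the crux BY NAME — its type is literally the route
declaration `…Theses.GammaCornerAnomaly.LegendreMUMConstant`; `sorryAx` enters only through the three named stubs
`stub_unfoldStratum`, `stub_peelLogFour`, `stub_regularPartIdentity`, fed into the sorry-free arrow form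
`legendreMUMConstant_of_stubs : stub₁-sig → stub₂-sig → stub₃-sig → (crux statement verbatim)`).
[cite: KontsevichZagier2001, §1.2] -/
theorem LegendreMUMConstant_of : LegendreMUMConstant :=
  legendreMUMConstant_of_stubs stub_unfoldStratum stub_peelLogFour stub_regularPartIdentity

end Summit.KontsevichZagierPeriods.KontsevichZagierPeriods.Cruxes.LegendreMUMConstant.Birth
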